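import Mathlib
import Summits.Langlands.Langlands.Theorems.QuadraticWindowTwistUnpackaging
import Literature.NumberTheory.GaloisRepresentations.ArtinCharacterReciprocityProofs
import Literature.NumberTheory.GaloisRepresentations.GaloisRepFrobeniusProofs
import Summits.Langlands.Langlands.Theorems.QuadraticWindowTwistNormalizationIndexTwo

/-!
# Support for `TwistNormalization` (route `QuadraticWindow`, stmt-Langlands-10904), IV:
# rank-one Frobenius bookkeeping and the separating character of odd prime exponent

* Rank one: Frobenius clauses of `ρ : Γ_K → GL_1` read through `det` (`hasFrobCharpolyAt_iff_det`),
  the value is unique and exists at unramified places, a Frobenius clause forces unramifiedness.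
* `exists_separatingCharacter` — for the quadratic `F/F₀` (automorphism `τ`, lift `t ∈ Γ_{F₀}`), a
  rational prime `ℓ`, a bound `n` and a `τ`-moved place `w₀`, there are a prime `p > max(n,2)`, a
  character `θ₁ : Γ_F → ℂˣ` with open kernel and `θ₁^p = 1`, and a Hecke character `ϑ` of `F` of
  finite order, unramified above `ℓ`, with `θ₁(Frob_w) = ϑ(ϖ_w)` and `ϑ(ϖ_w)^p = 1` at almost every
  `w`, such that `ϑ(ϖ_w) ≠ ϑ(ϖ_{τ • w})` for INFINITELY many `w`.  Construction: the separating ray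
  class avatar of the tree (`separatingTwists_of_stubs`: Kummer theory + a Thaine prime), Artin
  reciprocity for characters (`artinReciprocity_character_holds`, Tate, Cassels–Fröhlich VII §5) for
  the Hecke character, and Chebotarev (`chebotarev_artinRep_holds`) applied to
  `θ₁ · (θ₁ ∘ θ_t)⁻¹` for the infinitude.

References: J. Tate, *Global class field theory*, Cassels–Fröhlich Ch. VII §2.4, §5.1;
J.-P. Serre, *Abelian ℓ-adic representations* (1968), Ch. I §2.
-/

set_option linter.dupNamespace false -- project-wide option (lakefile weak.linter.dupNamespace); `Summit.Langlands.Langlands` is the mandated namespace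

noncomputable section

open Literature.NumberTheory.GaloisRepresentations Literature.NumberTheory.Automorphic
open Field IsDedekindDomain NumberField Polynomial Filter
open scoped MatrixGroups

namespace Summit.Langlands.Langlands.Theorems.TwistNormalization

/-! ## Rank-one Frobenius bookkeeping -/

section RankOne

variable {K : Type} [Field K] [NumberField K]

/-- A Frobenius clause `X - C a` of a rank-one `ρ` read through `det ρ`. [folklore] -/
theorem hasFrobCharpolyAt_iff_det (ρ : FramedGaloisRep K ℂ 1) (v : HeightOneSpectrum (𝓞 K)) (a : ℂ) :
    ρ.HasFrobCharpolyAt v (X - C a) ↔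
      ∀ 𝔓 ∈ v.primesAbove, ∀ Φ : absoluteGaloisGroup K, IsArithFrobAt (𝓞 K) Φ 𝔓 →
        ((FramedRep.det ρ Φ : ℂˣ) : ℂ) = a := by
  rw [FramedGaloisRep.hasFrobCharpolyAt_iff_of_rank_one]
  refine forall₂_congr fun 𝔓 _ => forall₂_congr fun Φ _ => ?_
  rw [FramedRep.det_apply, Matrix.GeneralLinearGroup.val_det_apply, Matrix.det_fin_one]

/-- Uniqueness of the rank-one Frobenius value. [folklore] -/
theorem frobValue_unique {ρ : FramedGaloisRep K ℂ 1} {v : HeightOneSpectrum (𝓞 K)} {a b : ℂ}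
    (ha : ρ.HasFrobCharpolyAt v (X - C a)) (hb : ρ.HasFrobCharpolyAt v (X - C b)) : a = b := by
  obtain ⟨𝔓, h𝔓⟩ := v.primesAbove_nonempty
  obtain ⟨Φ, hΦ⟩ := HeightOneSpectrum.exists_isArithFrobAt_of_mem_primesAbove_holds h𝔓
  rw [hasFrobCharpolyAt_iff_det] at ha hb
  rw [← ha 𝔓 h𝔓 Φ hΦ, ← hb 𝔓 h𝔓 Φ hΦ]

/-- In rank one, a Frobenius clause forces unramifiedness. [folklore] -/
theorem isUnramifiedAt_of_hasFrobCharpolyAt_rankOne {ρ : FramedGaloisRep K ℂ 1}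
    {v : HeightOneSpectrum (𝓞 K)} {a : ℂ} (ha : ρ.HasFrobCharpolyAt v (X - C a)) :
    ρ.IsUnramifiedAt v := by
  intro 𝔓 h𝔓 σ hσ
  obtain ⟨Φ, hΦ⟩ := HeightOneSpectrum.exists_isArithFrobAt_of_mem_primesAbove_holds h𝔓
  rw [hasFrobCharpolyAt_iff_det] at ha
  have h1 := ha 𝔓 h𝔓 _ ((isArithFrobAt_mul_iff_of_mem_inertia hσ).mpr hΦ)
  rw [← ha 𝔓 h𝔓 Φ hΦ, map_mul, Units.val_mul] at h1
  have h2 : FramedRep.det ρ σ = 1 :=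
    Units.ext (mul_eq_right₀ (Units.ne_zero _) |>.mp h1)
  exact (det_eq_one_iff_rankOne ρ σ).mp h2

/-- At an unramified place a rank-one `ρ` has a Frobenius value. [folklore] -/
theorem exists_hasFrobCharpolyAt_of_isUnramifiedAt_rankOne {ρ : FramedGaloisRep K ℂ 1}
    {v : HeightOneSpectrum (𝓞 K)} (h : ρ.IsUnramifiedAt v) :
    ∃ a : ℂ, ρ.HasFrobCharpolyAt v (X - C a) := by
  obtain ⟨𝔓, h𝔓⟩ := v.primesAbove_nonempty
  obtain ⟨Φ, hΦ⟩ := HeightOneSpectrum.exists_isArithFrobAt_of_mem_primesAbove_holds h𝔓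
  refine ⟨((FramedRep.det ρ Φ : ℂˣ) : ℂ), ?_⟩
  have h' : ρ.toGaloisRep.IsUnramifiedAt v := (FramedGaloisRep.isUnramifiedAt_toGaloisRep_iff v ρ).mpr h
  have h1 := (FramedGaloisRep.hasFrobCharpolyAt_toGaloisRep_iff v _ ρ).mp (h'.hasFrobCharpolyAt_charpoly h𝔓 hΦ)
  have e1 := h1 𝔓 h𝔓 Φ hΦ
  rw [← e1] at h1
  have e : FramedRep.charpoly ρ Φ = X - C ((FramedRep.det ρ Φ : ℂˣ) : ℂ) := by
    rw [FramedRep.charpoly, Matrix.charpoly, Matrix.det_fin_one, Matrix.charmatrix_apply_eq,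
      FramedRep.det_apply, Matrix.GeneralLinearGroup.val_det_apply, Matrix.det_fin_one]
  rwa [e] at h1

/-- The kernel of `det ρ` is open for a rank-one Artin representation. [folklore] -/
theorem isOpen_ker_det (ρ : FramedGaloisRep K ℂ 1) :
    IsOpen (((FramedRep.det ρ).toMonoidHom.ker : Subgroup (absoluteGaloisGroup K)) :
      Set (absoluteGaloisGroup K)) := by
  have h : (((FramedRep.det ρ).toMonoidHom.ker : Subgroup (absoluteGaloisGroup K)) :
      Set (absoluteGaloisGroup K)) = ρ.toMonoidHom.ker := by
    ext σ
    simp only [SetLike.mem_coe, MonoidHom.mem_ker]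
    exact det_eq_one_iff_rankOne ρ σ
  rw [h]
  exact FramedArtinRep.isOpen_ker_toMonoidHom ρ

end RankOne

/-! ## The separating character -/

section Separating

variable {F₀ F : Type} [Field F₀] [NumberField F₀] [Field F] [NumberField F] [Algebra F₀ F]

/-- **The separating character of odd prime exponent.**  Let `[F : F₀] = 2` with non-trivial
automorphism `τ` and a lift `t ∈ Γ_{F₀}`, `ℓ` a rational prime, `n` a bound and `w₀` a place of
`F` with `τ • w₀ ≠ w₀`.  There are a prime `p > max(n, 2)`, a character `θ₁ : Γ_F → ℂˣ` with open
kernel and `θ₁^p = 1`, and a Hecke character `ϑ` of `F` of finite order such that: `ϑ` is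
unramified above `ℓ`; at almost every `w`, `ϑ` is unramified, `ϑ(ϖ_w)^p = 1` and
`θ₁(Φ) = ϑ(ϖ_w)` for every arithmetic Frobenius `Φ` above `w`; and `ϑ(ϖ_w) ≠ ϑ(ϖ_{τ • w})` for
infinitely many `w`.  (Separating ray class twist of the tree + Artin reciprocity for characters +
Chebotarev for `θ₁ (θ₁ ∘ θ_t)⁻¹`.)  Tate, Cassels–Fröhlich VII §2.4, §5.1. -/
theorem exists_separatingCharacter (hdeg : Module.finrank F₀ F = 2) {τ : F ≃ₐ[F₀] F} (hτ : τ ≠ 1)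
    {t : absoluteGaloisGroup F₀}
    (ht : haveI := isGalois_of_finrank_eq_two hdeg; absGaloisQuot F₀ F t = τ)
    (ℓ : ℕ) [Fact ℓ.Prime] (n : ℕ) {w₀ : HeightOneSpectrum (𝓞 F)} (hw₀ : τ • w₀ ≠ w₀) :
    ∃ (p : ℕ) (θ₁ : absoluteGaloisGroup F →* ℂˣ) (ϑ : HeckeCharacter F) (_ : ϑ.IsFiniteOrder),
      p.Prime ∧ n < p ∧ 2 < p ∧ IsOpen (θ₁.ker : Set (absoluteGaloisGroup F)) ∧
      (∀ g, θ₁ g ^ p = 1) ∧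
      (∀ w : HeightOneSpectrum (𝓞 F), ((ℓ : ℕ) : 𝓞 F) ∈ w.asIdeal → ϑ.IsUnramifiedAt w) ∧
      (∀ᶠ w : HeightOneSpectrum (𝓞 F) in cofinite, ϑ.IsUnramifiedAt w ∧ ϑ.valueAtUniformizer w ^ p = 1 ∧
        ∀ 𝔓 ∈ w.primesAbove, ∀ Φ : absoluteGaloisGroup F, IsArithFrobAt (𝓞 F) Φ 𝔓 →
          ((θ₁ Φ : ℂˣ) : ℂ) = ϑ.valueAtUniformizer w) ∧
      {w : HeightOneSpectrum (𝓞 F) | ϑ.valueAtUniformizer w ≠ ϑ.valueAtUniformizer (τ • w)}.Infinite := by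
  haveI := isGalois_of_finrank_eq_two hdeg
  classical
  -- the finite set of places above `ℓ`
  set S : Set (HeightOneSpectrum (𝓞 F)) := {w | ((ℓ : ℕ) : 𝓞 F) ∈ w.asIdeal} with hSdef
  have hS : S.Finite := by
    have hℓ : (Ideal.span {((ℓ : ℕ) : 𝓞 F)} : Ideal (𝓞 F)) ≠ 0 := by
      rw [Ne, Ideal.zero_eq_bot, Ideal.span_singleton_eq_bot]
      exact_mod_cast (Fact.out : ℓ.Prime).ne_zero
    refine (Ideal.finite_factors hℓ).subset fun v hv => ?_
    exact (Ideal.dvd_span_singleton).mpr hv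
  -- the separating avatar of the tree
  obtain ⟨p, Q, c, e, hp, hmp, hQ, hQS, hTQ, hcp, hcT, hep, hecc, heF⟩ :=
    TwistUnpackaging.KummerChebotarev.separatingTwists_of_stubs F₀ F τ hdeg hτ S {w₀} (max n 2) hS
      (fun w hw => by rw [Finset.mem_singleton] at hw; rw [hw]; exact hw₀)
  have hnp : n < p := lt_of_le_of_lt (le_max_left _ _) hmp
  have h2p : 2 < p := lt_of_le_of_lt (le_max_right _ _) hmp
  obtain ⟨hw₀Q, hτw₀Q⟩ := hTQ w₀ (Finset.mem_singleton_self _)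
  set E : FramedGaloisRep F ℂ 1 := e 1 with hE
  set θ₁ : absoluteGaloisGroup F →* ℂˣ := (FramedRep.det E).toMonoidHom with hθ₁
  have hθ₁E : ∀ g, θ₁ g = FramedRep.det E g := fun _ => rfl
  -- Frobenius values of `E` and of `E^t`
  have hEfrob : ∀ v ∉ Q, ∀ 𝔓 ∈ v.primesAbove, ∀ Φ, IsArithFrobAt (𝓞 F) Φ 𝔓 →
      ((θ₁ Φ : ℂˣ) : ℂ) = c v := fun v hv => by
    have h := (heF 1 v hv).2
    rw [pow_one, hasFrobCharpolyAt_iff_det] at h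
    exact h
  have hEtfrob : ∀ v, τ • v ∉ Q → ∀ 𝔓 ∈ v.primesAbove, ∀ Φ, IsArithFrobAt (𝓞 F) Φ 𝔓 →
      ((θ₁ (absGaloisOuterConj F₀ F t Φ) : ℂˣ) : ℂ) = c (τ • v) := fun v hv => by
    have h := (heF 1 (τ • v) hv).2
    rw [pow_one, ← ht, ← FramedGaloisRep.hasFrobCharpolyAt_outerConj_iff t, hasFrobCharpolyAt_iff_det] at h
    intro 𝔓 h𝔓 Φ hΦ
    have h' := h 𝔓 h𝔓 Φ hΦ
    rw [ht] at h'
    rw [← h']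
    rfl
  -- the Hecke character of `E` (Artin reciprocity for characters)
  obtain ⟨ϑ, hϑfin, hϑ⟩ := artinReciprocity_character_holds F E
  have hϑval : ∀ v ∉ Q, ϑ.IsUnramifiedAt v ∧ ϑ.valueAtUniformizer v = c v := fun v hv => by
    obtain ⟨hunr, hfrob⟩ := hϑ v (heF 1 v hv).1
    refine ⟨hunr, frobValue_unique hfrob ?_⟩
    have := (heF 1 v hv).2
    rwa [pow_one] at this
  have hQc : ∀ᶠ w : HeightOneSpectrum (𝓞 F) in cofinite, w ∉ Q := hQ.compl_mem_cofinite
  have hτinj : Function.Injective fun w : HeightOneSpectrum (𝓞 F) => τ • w := MulAction.injective τ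
  have hQτc : ∀ᶠ w : HeightOneSpectrum (𝓞 F) in cofinite, τ • w ∉ Q := hτinj.tendsto_cofinite.eventually hQc
  refine ⟨p, θ₁, ϑ, hϑfin, hp, hnp, h2p, ?_, fun g => ?_, fun w hw => ?_, ?_, ?_⟩
  · rw [hθ₁]; exact isOpen_ker_det E
  · have hEp : ∀ g, E g ^ p = 1 := hep 1
    rw [hθ₁E, FramedRep.det_apply, ← map_pow, hEp g, map_one]
  · exact (hϑval w (fun hwQ => hQS w hwQ hw)).1
  · filter_upwards [hQc] with w hw
    obtain ⟨hunr, hval⟩ := hϑval w hw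
    exact ⟨hunr, by rw [hval]; exact hcp w hw, fun 𝔓 h𝔓 Φ hΦ => by rw [hval]; exact hEfrob w hw 𝔓 h𝔓 Φ hΦ⟩
  · -- Chebotarev for `χ = θ₁ · (θ₁ ∘ θ_t)⁻¹`
    set χ : absoluteGaloisGroup F →* ℂˣ := θ₁ * (θ₁.comp (absGaloisOuterConj F₀ F t).toMonoidHom)⁻¹
      with hχ
    have hχapp : ∀ g, χ g = θ₁ g * (θ₁ (absGaloisOuterConj F₀ F t g))⁻¹ := fun g => rfl
    have hχopen : IsOpen (χ.ker : Set (absoluteGaloisGroup F)) := by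
      have h1 : IsOpen ((θ₁.ker : Subgroup (absoluteGaloisGroup F)) : Set (absoluteGaloisGroup F)) := by
        rw [hθ₁]; exact isOpen_ker_det E
      have h2 : IsOpen (((θ₁.ker : Subgroup (absoluteGaloisGroup F)).comap
          (absGaloisOuterConj F₀ F t).toMonoidHom : Subgroup (absoluteGaloisGroup F)) :
            Set (absoluteGaloisGroup F)) :=
        h1.preimage (absGaloisOuterConj F₀ F t).continuous
      apply Subgroup.isOpen_mono (H₁ := θ₁.ker ⊓ (θ₁.ker).comap (absGaloisOuterConj F₀ F t).toMonoidHom)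
      · intro g hg
        rw [MonoidHom.mem_ker, hχapp, MonoidHom.mem_ker.mp hg.1, show θ₁ (absGaloisOuterConj F₀ F t g) = 1 from hg.2,
          inv_one, mul_one]
      · exact h1.inter h2
    set R : FramedGaloisRep F ℂ 1 := FramedGaloisRep.ofOpenKer χ hχopen with hR
    -- a Frobenius at `w₀`, where `χ(Frob) = c w₀ / c (τ • w₀) ≠ 1`
    obtain ⟨𝔓₀, h𝔓₀⟩ := w₀.primesAbove_nonempty
    obtain ⟨Φ₀, hΦ₀⟩ := HeightOneSpectrum.exists_isArithFrobAt_of_mem_primesAbove_holds h𝔓₀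
    have hc0 : ∀ v ∉ Q, c v ≠ 0 := fun v hv h0 => by
      have := hcp v hv; rw [h0, zero_pow hp.ne_zero] at this; exact zero_ne_one this
    have hχΦ₀ : ((χ Φ₀ : ℂˣ) : ℂ) = c w₀ * (c (τ • w₀))⁻¹ := by
      rw [hχapp, Units.val_mul, Units.val_inv_eq_inv_val, hEfrob w₀ hw₀Q 𝔓₀ h𝔓₀ Φ₀ hΦ₀,
        hEtfrob w₀ hτw₀Q 𝔓₀ h𝔓₀ Φ₀ hΦ₀]
    have hcheb := chebotarev_artinRep_holds F 1 R Φ₀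
    -- the Chebotarev set, away from `Q ∪ τ⁻¹Q`, separates
    refine ((hcheb.sdiff hQ).sdiff (hQ.preimage hτinj.injOn)).mono ?_
    rintro v ⟨⟨⟨-, 𝔓, h𝔓, φ, hφ, hRφ⟩, hvQ⟩, hτvQ⟩
    simp only [Set.mem_preimage] at hτvQ
    have hχφ : χ φ = χ Φ₀ := by
      have h := congrArg (fun M : GL (Fin 1) ℂ => (M : Matrix (Fin 1) (Fin 1) ℂ) 0 0) hRφ
      simp only [hR, FramedGaloisRep.ofOpenKer_apply_coe] at h
      exact Units.ext h
    have hval : ((χ φ : ℂˣ) : ℂ) = c v * (c (τ • v))⁻¹ := by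
      rw [hχapp, Units.val_mul, Units.val_inv_eq_inv_val, hEfrob v hvQ 𝔓 h𝔓 φ hφ, hEtfrob v hτvQ 𝔓 h𝔓 φ hφ]
    simp only [Set.mem_setOf_eq, (hϑval v hvQ).2, (hϑval (τ • v) hτvQ).2]
    intro heq
    apply hcT w₀ (Finset.mem_singleton_self _)
    have h1 : c v * (c (τ • v))⁻¹ = 1 := by rw [heq, mul_inv_cancel₀ (hc0 _ hτvQ)]
    have h2 : c w₀ * (c (τ • w₀))⁻¹ = 1 := by rw [← hχΦ₀, ← hχφ, hval, h1]
    rw [mul_inv_eq_one₀ (hc0 _ hτw₀Q)] at h2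
    exact h2.symm

end Separating

end Summit.Langlands.Langlands.Theorems.TwistNormalization

end
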